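import Summits.ABC.IUTFork.Joshi.AnsatzGaloisIsometry
import Summits.ABC.IUTFork.Joshi.LogLinkColumn
import Mathlib.Algebra.Ring.Parity

/-!
# The valuation scales reachable by Joshi's OWN symmetries of the Ansatz (Galois and Frobenius): powers of `p` only — the
# `j²`-profile of an Ansatz tuple is not reachable from its first entry at an odd prime (located, not adjudicated)

Block E, seat abc-iut-E-t7 (slot T-07 = [J-III] §4.1–4.2: the three actions `G_{L′}`, `ϕ^ℤ`, `L′*` on `Σ̃_{L′}`, Thm. 4.2.2.1;
`L′*` acts at finite places THROUGH powers of Frobenius, [J-2½] Thm. 4.2.3 (4) = `AdelicCurveDatum.LStarThroughFrobenius`), local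
shadow over abc-iut-E-t3's `PrototypeDatum` ([J-IIp] = K. Joshi, arXiv:2303.01662v3, bib `Joshi2023ATS2Local`; files
`Joshi/PrimitiveAnsatz.lean` p428639, `Joshi/LogLinkColumn.lean` p429867) and abc-iut-E-t2's `Joshi/AnsatzGaloisIsometry.lean`
(p430404) BY NAME. TAKES NO SIDE on [IUTchIII] Cor. 3.12, on Joshi's claims, or on Mochizuki's reports on them; typed ≠ proved.

WHAT IS SHOWN (all DERIVED from E-t3's signature fields `pt_gal`, `pt_frob`, `absF_galF`, `absK_pt` = [FF18 2.2.17]; no new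
claim, nothing asserted). E-t2 showed that the GALOIS symmetry of the primitive ansatz ([J-IIp] Prop. 6.7.1 / 6.13.1) preserves every
valuation scale (`scale_galY_pt`); E-t3 showed that FROBENIUS multiplies the scale by `p` ([J-IIp] Thm. 10.20.1 (3),
`scale_column_pt`). Here the two are put together for the monoid they generate — which, by [J-2½] Thm. 4.2.3 (4), also covers the
`L′*`-action at a finite place (uniformisers act by Frobenius, units trivially):
* `Reach a y` — `y` is obtained from the base point `y_a = pt a` by finitely many Galois moves and Frobenius steps (the local
  symmetry monoid of [J-III] Thm. 4.2.2.1 (1)–(3) / [J-IIp] Prop. 6.13.1 acting on ONE entry);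
* `Reach.exists_param` — every reachable point is `y_b` with `b ∈ 𝔪_F ∖ 0` and `|b|_F = |a|_F^{pⁿ}` for some `n`; hence
  `Reach.scale_eq` : `scale y = pⁿ · scale (y_a)` — THE REACHABLE SCALES ARE `p`-POWER MULTIPLES of the base scale;
* versus [J-IIp] Thm. 6.9.1 (`scale_ansatzPt` : the `j`-th entry of the Ansatz tuple of `a` has scale `j² · scale(y_a)`):
  `not_reach_ansatzPt_of_not_pow` — if `j²` is not a power of `p`, NO word in Galois ∪ Frobenius carries `y_1(a) = y_a` to (the
  scale of) the `j`-th entry `y_j(a)`; in particular `not_reach_ansatzPt_two_of_odd` — at an ODD prime `p` (every `w ∈ V^{odd,ss}`,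
  [J-III] §3.2 (6)) the second entry (`j = 2`, factor `4`) is unreachable, for every `ℓ* ≥ 2`.
LOCATED SENTENCE (for E-plan's §M / E-cx's X-02, X-06; our side BY NAME only, R14): in Joshi's own construction the symmetries of
`Σ̃` that he lists ([J-III] Thm. 4.2.2.1; his (Ind1)-analogue = Galois, his (Ind3)/log-link direction = Frobenius) move residue
valuation scales only within `{pⁿ}`; the `j²`-profile separating the Θ-side entries from the first entry ([J-IIp] Thm. 6.9.1 =
[J-III] Thm. 4.2.2.1 (4)) is therefore NOT produced by these symmetries at odd `p` — it is a property of the CHOICE OF ENTRY of the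
Ansatz tuple, i.e. of the Θ^{gau}-link datum itself (cf. OUR pinned countermodel, where `(q, …, q)` is no
`⟨Ind1 ∪ Ind2⟩`-translate of `(q, q⁴, …)`: `Cor312PinnedCountermodel.orbitRegion_separates`). Located, not adjudicated.
-/

noncomputable section

open Set

namespace Summit.ABC.IUTFork.Joshi

namespace PrototypeDatum

variable {F B E0 : Type} [Field F] [CommRing B] [Field E0] {Y : Type} {K : Y → Type} [∀ y, Field (K y)] {G : Type}
  (P : PrototypeDatum F B E0 Y K G)

/-- **The local symmetry monoid of the Ansatz acting on one entry**: `y` is REACHABLE from the base point `y_a` if it is obtained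
from `pt a` by finitely many Galois moves `σ ∈ G` ([J-IIp] Prop. 6.7.1 / 6.13.1; [J-III] Thm. 4.2.2.1 (1)) and Frobenius steps
([J-IIp] Prop. 6.6.1, §10.13; [J-III] Thm. 4.2.2.1 (2), and (3) at finite places via [J-2½] Thm. 4.2.3 (4)). DEFINITION.
[claim: Joshi2023ATS2Local, status: disputed] -/
inductive Reach (a : F) : Y → Prop
  | base : Reach a (P.pt a)
  | gal (g : G) {y : Y} : Reach a y → Reach a (P.galY g y)
  | frob {y : Y} : Reach a y → Reach a (P.frobY y)

section
variable {P}

/-- Every reachable point is the point of a parameter `b` with `|b|_F = |a|_F^{pⁿ}` for some `n` (Galois is an isometry of `F`,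
`absF_galF`; Frobenius is `a ↦ a^p`, `pt_frob`). DERIVED. [folklore] -/
theorem Reach.exists_param {a : F} {y : Y} (h : P.Reach a y) :
    ∃ (b : F) (n : ℕ), y = P.pt b ∧ P.absF b = P.absF a ^ P.p ^ n := by
  induction h with
  | base => exact ⟨a, 0, rfl, by simp⟩
  | gal g _ ih =>
      obtain ⟨b, n, rfl, hb⟩ := ih
      exact ⟨P.galF g b, n, (P.pt_gal g b).symm, by rw [P.absF_galF, hb]⟩
  | frob _ ih =>
      obtain ⟨b, n, rfl, hb⟩ := ih
      exact ⟨b ^ P.p, n + 1, (P.pt_frob b).symm, by rw [map_pow, hb, ← pow_mul, pow_succ]⟩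

/-- Reachable points of an Ansatz parameter are points of Ansatz parameters. [folklore] -/
theorem Reach.exists_ansatzParam {a : F} (ha : a ∈ P.AnsatzParam) {y : Y} (h : P.Reach a y) :
    ∃ (b : F) (n : ℕ), y = P.pt b ∧ b ∈ P.AnsatzParam ∧ P.absF b = P.absF a ^ P.p ^ n := by
  obtain ⟨b, n, rfl, hb⟩ := h.exists_param
  refine ⟨b, n, rfl, ⟨fun hb0 => ?_, ?_⟩, hb⟩
  · have : P.absF a ^ P.p ^ n = 0 := by rw [← hb, hb0, map_zero]
    exact ha.1 ((map_eq_zero P.absF).1 (pow_eq_zero_iff (pow_ne_zero n P.p_prime.ne_zero) |>.1 this))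
  · rw [hb]; exact pow_lt_one₀ (P.absF.nonneg a) ha.2 (pow_ne_zero n P.p_prime.ne_zero)

/-- **The reachable scales are `p`-power multiples of the base scale**: `scale y = pⁿ · scale(y_a)`. DERIVED
(`absK_pt` = [FF18 2.2.17] and the exponent bookkeeping of E-t3's `scale_column_pt`). [claim: Joshi2023ATS2Local, status: disputed] -/
theorem Reach.scale_eq {a : F} (ha : a ∈ P.AnsatzParam) {y : Y} (h : P.Reach a y) :
    ∃ n : ℕ, P.scale y = (P.p ^ n : ℕ) * P.scale (P.pt a) := by
  obtain ⟨b, n, rfl, hb, hab⟩ := h.exists_ansatzParam ha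
  refine ⟨n, ?_⟩
  -- compare through the column: `pt (a ^ p ^ n)` has the same `|p|`-reading as `pt b`
  have h1 : P.absK (P.pt b) (P.p : K (P.pt b)) = P.absK (P.pt (a ^ P.p ^ n)) (P.p : K (P.pt (a ^ P.p ^ n))) := by
    have hapn := P.pow_p_pow_mem ha.1 ha.2 n
    rw [P.absK_pt b hb.1 hb.2, P.absK_pt _ hapn.1 hapn.2, map_pow, hab]
  have h2 : P.scale (P.pt b) = P.scale (P.pt (a ^ P.p ^ n)) := by
    apply P.rpow_abs0_p_inj
    rw [← P.absK_natCast_p, ← P.absK_natCast_p, h1]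
  rw [h2, ← P.column_pt, P.scale_column_pt ha.1 ha.2 n]

/-- **No word in Galois ∪ Frobenius realises a non-`p`-power rescaling**: if `(j)² = (i+1)²` is not a power of `p`, the `j`-th
entry `y_j(a)` of the Ansatz tuple of `a` (scale `j² · scale(y_a)`, [J-IIp] Thm. 6.9.1 = E-t3's `scale_ansatzPt`) is NOT reachable
from the first entry `y_1(a) = y_a`. DERIVED. [claim: Joshi2023ATS2Local, status: disputed] -/
theorem not_reach_ansatzPt_of_not_pow {a : F} (ha : a ∈ P.AnsatzParam) (i : Fin P.lstar)
    (hi : ∀ n : ℕ, ((i : ℕ) + 1) ^ 2 ≠ P.p ^ n) : ¬ P.Reach a (P.ansatzPt a i) := by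
  intro h
  obtain ⟨n, hn⟩ := h.scale_eq ha
  rw [P.scale_ansatzPt ha i] at hn
  have hs := P.scale_pos (P.pt a)
  have : ((((i : ℕ) + 1) ^ 2 : ℕ) : ℝ) = ((P.p ^ n : ℕ) : ℝ) := mul_right_cancel₀ hs.ne' hn
  exact hi n (by exact_mod_cast this)

/-- `4` is not a power of an odd number. [folklore] -/
theorem four_ne_pow_of_odd {p : ℕ} (hp : Odd p) (n : ℕ) : (4 : ℕ) ≠ p ^ n := by
  intro h
  have : Odd (p ^ n) := hp.pow
  rw [← h] at this
  exact (Nat.not_even_iff_odd.mpr this) (by decide)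

/-- **At an ODD prime, the second entry is unreachable from the first** (`j = 2`, factor `4`; every `w ∈ V^{odd,ss}` has odd residue
characteristic, [J-III] §3.2 (6)): for `ℓ* ≥ 2`, no composite of Joshi's Galois and Frobenius symmetries carries `y_1(a)` to
`y_2(a)`. DERIVED. [claim: Joshi2023ATS2Local, status: disputed] -/
theorem not_reach_ansatzPt_two_of_odd (hp : Odd P.p) (hl : 2 ≤ P.lstar) {a : F} (ha : a ∈ P.AnsatzParam) :
    ¬ P.Reach a (P.ansatzPt a ⟨1, hl⟩) :=
  not_reach_ansatzPt_of_not_pow ha ⟨1, hl⟩ fun n => by simpa using four_ne_pow_of_odd hp n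

/-- … and more generally no reachable point even has the SCALE of the second entry at an odd prime (the obstruction is the
valuation scale itself, not the point). DERIVED. [claim: Joshi2023ATS2Local, status: disputed] -/
theorem scale_ne_of_reach_of_odd (hp : Odd P.p) (hl : 2 ≤ P.lstar) {a : F} (ha : a ∈ P.AnsatzParam) {y : Y}
    (h : P.Reach a y) : P.scale y ≠ P.scale (P.ansatzPt a ⟨1, hl⟩) := by
  obtain ⟨n, hn⟩ := h.scale_eq ha
  rw [hn, P.scale_ansatzPt ha]
  intro heq
  have hs := P.scale_pos (P.pt a)
  have : ((P.p ^ n : ℕ) : ℝ) = ((((1 : ℕ) + 1) ^ 2 : ℕ) : ℝ) := mul_right_cancel₀ hs.ne' heq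
  exact four_ne_pow_of_odd hp n (by exact_mod_cast this.symm)

end

/-- The first entry itself is (trivially) reachable, and so is every point of its forward Frobenius column and every Galois
translate — the reachable set is exactly where Joshi's listed symmetries can take the q-side reading. [folklore] -/
theorem reach_column (a : F) (n : ℕ) : P.Reach a (P.column (P.pt a) n) := by
  induction n with
  | zero => exact Reach.base
  | succ n ih => rw [P.column_succ]; exact Reach.frob ih

end PrototypeDatum

end Summit.ABC.IUTFork.Joshi

end
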